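import Summits.BirchSwinnertonDyer.Rank1Residual.F1Sign2.KummerRankCertificate
import Mathlib.Topology.Algebra.Polynomial
import Mathlib.Topology.Order.IntermediateValue
import Mathlib.LinearAlgebra.Matrix.Charpoly.Minpoly
import Mathlib.LinearAlgebra.Charpoly.ToMatrix
import Mathlib.RingTheory.Norm.Basic
import HarnessLib

/-!
# DESC-§22-H⁗/H∞/H∞′/HN — the congruence criterion and the local conditions on the Kummer image (real place, norm)

READY-TO-LAND continuation of the tree modules `F1Sign2/KummerHalvingCriterion.lean` (p625024, part A) and
`F1Sign2/KummerRankCertificate.lean` (p625143, part B = H″/H‴): this file = H⁗ (`kummerElt_ne_zero`,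
`add_mem_two_iff_isSquare_mul`, `KummerCongruenceCriterion` + `_holds`: `c_W` irreducible ⇒ (`P + Q ∈ 2W(ℚ) ⟺ κ(P)κ(Q) ∈ L²`))
+ H∞ (`KummerPositivityAtLeastRealRoot`: `σ_min(κ(P)) > 0`, IVT + `AdjoinRoot.liftAlgHom`) + H∞′ (`KummerRealSignsThreeRoots`:
three real roots ⇒ sign vector `(+,+,+)` or `(+,−,−)`) + HN (`norm_algebraMap_sub_twoDivisionRoot : N(a − θ) = c_W(a)`,
`KummerNormIsSquare`: `N(κ(P)) = 64y_P² ∈ ℚ^{×2}`).  Check evidence: `HOME/MEMO-desc-data/g14/lean/KummerGeneral-v7-concat.lean`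
d27ce6a8905029de (A + B + this file's content in this order; rc 0 / 0 warnings / 0 sorries; axioms {propext, Classical.choice, Quot.sound}).
Sources: Cassels, LMSST 24 (1991) §15, Lemma 1–2 and `Norm(a − Θ) = F(a)` [corpus:book:cassels1991-lmsst-lectures-elliptic-curves p.42–44];
Silverman, AEC 2nd ed., Prop. X.1.4 (split case) [corpus:book:silverman2009-arithmetic-elliptic-curves-2nd-ed p.270].

TYPER FILING (cell `bsd-f1-sign2`, seat `-ty` g9; CANDIDATES.md rows DESC-§22-H⁗/H∞/H∞′/HN; -desc g14 ADDENDUM 9, 2026-08-28T10:49:59Z): the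
planner's file `HOME/MEMO-desc-data/g14/lean/KummerCongruenceRealNorm.lean` e00d507e8c679dac (317 l.) VERBATIM from `noncomputable section` to
`end`; typer edits = this paragraph, the REF1 and REF2 verdict sentences and `[cite: …]` tags in the four row docstrings (REF1 riders r1, r3 folded as
docstring sentences), one-line docstrings on `kummerElt_ne_zero` and the four `_holds` (tree lint); statements and proofs byte-identical.  Builder `tools/mk_kcrn.py`, published with the filed text under `HOME/MEMO-ty-data/g9/`.
REF1-AUDIT §94 (g9, 2026-08-28T10:59:52Z): SURVIVES, PROVED, CLEARED; A1 rc 0 · axioms trio 19/19 (Probe94 db72c4ec92eada0c); hypotheses audit: `Irreducible` load-bearing in H‴/H⁗/H∞ (kernel witnesses e1 `y² = x³ − x`, e2 `y² = x(x−2)(x−8)`: `κ((2,0))·κ((8,0))` is a square but `(0,0) ∉ 2W(ℚ)`, e5), `a₁ = a₃ = 0` decoration in HN (e4); Cassels LMSST §15 pp. 42–43 (Norm(a−Θ) = F(a); 𝓜; μ with patch (iii); Lemmas 1–2); cmpdecls of this file vs the audited B∪C sources 19 SAME / 0 DIFF.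
REF2-PLACEMENT v24 §1 P.S. (2026-08-28T10:28:24Z): H⁗ = KNOWN (Cassels 1991 §15 Lemma 1 + Lemma 2 = injectivity of `E(ℚ)/2E(ℚ) ↪ L^×/L^{×2}`, the
standard 2-descent embedding; also Schaefer 1995, Stoll 2001 §4); v25 §1 (0fe067e0b1982f3b, 10:54:27Z): H∞/H∞′/HN = KNOWN (Stoll 2001 Acta Arith. 98
Lemma 4.8 and the following paragraph «image at ∞ … given by the collection of signs of x − α for all the real roots α»; Silverman ATAEC V Cor. 2.3.1,
Thm 2.4; Cassels 1991 §15 p. 46 worked instance and «Norm(a − Θ) = F(a)», 𝓜 = {Norm ∈ (ℚ^×)²} p. 42) — formalisation of print; beyond-print theorem: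
no; PARTITION: none (lens support rows; closes nothing on crux 23715).  BSD is not proved by any of this.
-/

noncomputable section

open scoped Classical

open WeierstrassCurve Polynomial

namespace Summit.BirchSwinnertonDyer.Rank1Residual.F1Sign2.Kummer
/-! ## Congruence criterion: `P ≡ Q (mod 2W(ℚ)) ⟺ κ(P)κ(Q) ∈ L²` (irreducible cubic)

With `c_W` irreducible `L` is a field, `κ(P) ≠ 0`, and H′ + H″ combine to: `P + Q ∈ 2W(ℚ) ⟺ κ(P)κ(Q)` is a
square — i.e. `κ̄ : W(ℚ)/2W(ℚ) → L^×/L^{×2}` is an INJECTIVE HOMOMORPHISM, stated without quotients. -/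

/-- The (unpatched) Kummer value `κ(P) = 4x_P − θ` (resp. `1` at `P = 0`) is never `0` in `L = ℚ[T]/(c_W)`. -/
lemma kummerElt_ne_zero (W : WeierstrassCurve ℚ) (P : W.toAffine.Point) : kummerElt W P ≠ 0 := by
  rcases P with _ | ⟨x, y, h⟩
  · intro h0
    change (1 : twoDivisionAlgebra W) = 0 at h0
    have := coords_eq_zero W 1 0 0 (by simpa using h0)
    exact one_ne_zero this.1
  · intro h0
    have := coords_eq_zero W (4 * x) (-1) 0 (by
      simp only [kummerElt_some, map_mul, map_ofNat] at h0
      simp only [map_mul, map_ofNat, map_neg, map_one, map_zero, zero_mul, add_zero]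
      linear_combination h0)
    exact absurd this.2.1 (by norm_num)

/-- **CONGRUENCE CRITERION**: `c_W` irreducible ⇒ (`P + Q ∈ 2W(ℚ) ⟺ κ(P)κ(Q) ∈ L²`). -/
theorem add_mem_two_iff_isSquare_mul (W : WeierstrassCurve ℚ) (h1 : W.a₁ = 0) (h3 : W.a₃ = 0)
    (hirr : Irreducible (twoDivisionUCubic W)) (P Q : W.toAffine.Point) :
    (∃ R : W.toAffine.Point, R + R = P + Q) ↔ IsSquare (kummerElt W P * kummerElt W Q) := by
  haveI : Fact (Irreducible (twoDivisionUCubic W)) := ⟨hirr⟩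
  have hhom := isSquare_kummerElt_mul_mul_add W h1 h3 P Q
  have hPQ0 : kummerElt W P * kummerElt W Q ≠ 0 := mul_ne_zero (kummerElt_ne_zero W P) (kummerElt_ne_zero W Q)
  have hR0 : kummerElt W (P + Q) ≠ 0 := kummerElt_ne_zero W (P + Q)
  constructor
  · intro hR
    have hsqR : IsSquare (kummerElt W (P + Q)) := (halves_iff_isSquare_kummerElt W h1 h3 (P + Q)).mp hR
    have hdiv := hhom.div hsqR
    rwa [mul_div_cancel_right₀ _ hR0] at hdiv
  · intro hsq
    have hdiv := hhom.div hsq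
    rw [mul_comm (kummerElt W P * kummerElt W Q), mul_div_cancel_right₀ _ hPQ0] at hdiv
    exact (halves_iff_isSquare_kummerElt W h1 h3 (P + Q)).mpr hdiv

/-- DESC-§22-H⁗ (support): `κ̄ : W(ℚ)/2W(ℚ) ↪ L^×/L^{×2}` is an injective homomorphism, quotient-free form:
for every `W : y² = x³ + a₂x² + a₄x + a₆` over `ℚ` with irreducible 2-division cubic and all `P, Q ∈ W(ℚ)`,
`P + Q ∈ 2W(ℚ) ⟺ κ(P)κ(Q) ∈ L²`.
REF1 §94: SURVIVES, PROVED, CLEARED; r3: `Irreducible` is necessary as typed (e2: on `y² = x(x−2)(x−8)` the product `κ((2,0))·κ((8,0))` is a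
square while `(2,0) + (8,0) = (0,0) ∉ 2W(ℚ)` — at a rational 2-torsion point the unpatched `κ` is a zero-divisor and Cassels' patch (iii),
LMSST p. 42, is needed).  REF2 v24 §1 P.S.: KNOWN — Cassels 1991 §15 Lemmas 1–2 (the standard 2-descent embedding); formalisation;
beyond-print no.  [cite: Cassels1991, §15 Lemma 1–2] -/
def KummerCongruenceCriterion : Prop :=
  ∀ (W : WeierstrassCurve ℚ), W.a₁ = 0 → W.a₃ = 0 → Irreducible (twoDivisionUCubic W) →
    ∀ (P Q : W.toAffine.Point), (∃ R : W.toAffine.Point, R + R = P + Q) ↔ IsSquare (kummerElt W P * kummerElt W Q)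

/-- Row DESC-§22-H⁗ holds (`add_mem_two_iff_isSquare_mul`). -/
theorem kummerCongruenceCriterion_holds : KummerCongruenceCriterion :=
  fun W h1 h3 hirr P Q => add_mem_two_iff_isSquare_mul W h1 h3 hirr P Q

/-! ## The local condition at the real place: positivity at the smallest real root

For `σ : L → ℝ` the real embedding at the SMALLEST real root `e = σ(θ)` of `c_W` and any `P ∈ W(ℚ)` (irreducible
`c_W`): `σ(κ(P)) > 0`.  (Reason: `c_W(4x_P) = 64 y_P² > 0` and the monic cubic `c_W` is negative to the left of its
smallest real root — an IVT argument producing, from `4x_P < e`, a real root below `e`, i.e. another embedding `τ`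
with `τ(θ) < σ(θ)`.)  This is the `∞`-adic Selmer condition on the Kummer image at the place singled out by the
smallest root; for a cubic with one real root it is the whole condition at `∞`. -/

/-- `c_W(4x) = 64y²` on the curve (`a₁ = a₃ = 0`). -/
lemma eval_twoDivisionUCubic_four_mul (W : WeierstrassCurve ℚ) (h1 : W.a₁ = 0) (h3 : W.a₃ = 0) {x y : ℚ}
    (h : W.toAffine.Equation x y) : (twoDivisionUCubic W).eval (4 * x) = 64 * y ^ 2 := by
  have heq := equation_of_a₁_a₃ W h1 h3 h
  simp only [twoDivisionUCubic, eval_add, eval_mul, eval_pow, eval_X, eval_C, b₂_of_a₁ W h1, b₄_of_a₁_a₃ W h1 h3,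
    b₆_of_a₃ W h3]
  linear_combination (-64) * heq

/-- A monic real cubic is negative far to the left: `s ≤ −(1 + |B| + |C| + |D|) ⇒ s³ + Bs² + Cs + D < 0`. -/
lemma cubic_neg_far_left (B C D s : ℝ) (hs : s ≤ -(1 + |B| + |C| + |D|)) :
    s ^ 3 + B * s ^ 2 + C * s + D < 0 := by
  set M : ℝ := -s with hM
  have hs' : s = -M := by rw [hM, neg_neg]
  have hM1 : 1 + |B| + |C| + |D| ≤ M := by rw [hM]; linarith
  have hB0 := abs_nonneg B
  have hC0 := abs_nonneg C
  have hD0 := abs_nonneg D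
  have hMge1 : 1 ≤ M := by linarith
  have hM0 : 0 ≤ M := by linarith
  have hMM : M ≤ M ^ 2 := by nlinarith
  have h1M : 1 ≤ M ^ 2 := by nlinarith
  have eB : B * M ^ 2 ≤ |B| * M ^ 2 := mul_le_mul_of_nonneg_right (le_abs_self B) (sq_nonneg M)
  have eC : -C * M ≤ |C| * M ^ 2 :=
    (mul_le_mul_of_nonneg_right (neg_le_abs C) hM0).trans (mul_le_mul_of_nonneg_left hMM hC0)
  have eD : D ≤ |D| * M ^ 2 := (le_abs_self D).trans (by nlinarith)
  have eS : (|B| + |C| + |D|) * M ^ 2 ≤ (M - 1) * M ^ 2 :=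
    mul_le_mul_of_nonneg_right (by linarith) (sq_nonneg M)
  rw [hs']
  have key : (-M) ^ 3 + B * (-M) ^ 2 + C * (-M) + D ≤ -M ^ 3 + (M - 1) * M ^ 2 := by nlinarith
  have hfin : -M ^ 3 + (M - 1) * M ^ 2 = -M ^ 2 := by ring
  linarith

/-- **POSITIVITY AT THE SMALLEST REAL ROOT**: `c_W` irreducible, `σ(θ)` the least value of `θ` over all real embeddings
⇒ `0 < σ(κ(P))` for every `P ∈ W(ℚ)`. -/
theorem kummerElt_pos_of_isLeast_root (W : WeierstrassCurve ℚ) (h1 : W.a₁ = 0) (h3 : W.a₃ = 0)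
    (hirr : Irreducible (twoDivisionUCubic W)) (σ : twoDivisionAlgebra W →ₐ[ℚ] ℝ)
    (hmin : ∀ τ : twoDivisionAlgebra W →ₐ[ℚ] ℝ, σ (twoDivisionRoot W) ≤ τ (twoDivisionRoot W))
    (P : W.toAffine.Point) : 0 < σ (kummerElt W P) := by
  rcases P with _ | ⟨x, y, hP⟩
  · change 0 < σ 1
    rw [map_one]; exact one_pos
  · simp only [kummerElt_some, map_sub, AlgHom.commutes]
    set c : ℝ[X] := (twoDivisionUCubic W).map (algebraMap ℚ ℝ) with hc
    set e : ℝ := σ (twoDivisionRoot W) with he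
    set t : ℝ := algebraMap ℚ ℝ (4 * x) with ht
    have hroot_e : c.eval e = 0 := by
      rw [hc, eval_map, ← aeval_def]; exact AdjoinRoot.aeval_algHom_eq_zero _ σ
    have hy : y ≠ 0 := fun h0 => not_equation_zero_of_irreducible W h1 h3 hirr (h0 ▸ hP.1)
    have hct : c.eval t = algebraMap ℚ ℝ (64 * y ^ 2) := by
      rw [hc, ht, eval_map, eval₂_hom, eval_twoDivisionUCubic_four_mul W h1 h3 hP.1]
    have hct_pos : 0 < c.eval t := by
      rw [hct, eq_ratCast]
      have : (0 : ℚ) < 64 * y ^ 2 := by positivity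
      exact_mod_cast this
    rcases lt_or_ge e t with hlt | hle
    · linarith
    rcases hle.lt_or_eq with hlt | heq
    · -- `t < e`: the cubic is negative far left and positive at `t`, so it has a real root `r ≤ t < e`.
      set s : ℝ := min (t - 1) (-(1 + |algebraMap ℚ ℝ W.b₂| + |algebraMap ℚ ℝ (8 * W.b₄)| + |algebraMap ℚ ℝ (16 * W.b₆)|))
        with hs
      have hst : s ≤ t := (min_le_left _ _).trans (by linarith)
      have hcs : c.eval s < 0 := by
        have hform : c.eval s = s ^ 3 + algebraMap ℚ ℝ W.b₂ * s ^ 2 + algebraMap ℚ ℝ (8 * W.b₄) * s +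
            algebraMap ℚ ℝ (16 * W.b₆) := by
          rw [hc]
          simp only [twoDivisionUCubic, Polynomial.map_add, Polynomial.map_mul, Polynomial.map_pow, map_X, map_C,
            eval_add, eval_mul, eval_pow, eval_X, eval_C]
        rw [hform]
        exact cubic_neg_far_left _ _ _ s (min_le_right _ _)
      have hcont : ContinuousOn (fun r => c.eval r) (Set.Icc s t) := c.continuous.continuousOn
      obtain ⟨r, ⟨_, hrt⟩, hr0⟩ := intermediate_value_Icc hst hcont ⟨hcs.le, hct_pos.le⟩
      have hr0' : (twoDivisionUCubic W).eval₂ (algebraMap ℚ ℝ) r = 0 := by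
        have : c.eval r = 0 := hr0
        rwa [hc, eval_map] at this
      let τ : twoDivisionAlgebra W →ₐ[ℚ] ℝ := AdjoinRoot.liftAlgHom (twoDivisionUCubic W) (Algebra.ofId ℚ ℝ) r hr0'
      have hτ : τ (twoDivisionRoot W) = r := by
        simp only [τ, twoDivisionRoot, AdjoinRoot.liftAlgHom_root]
      have := hmin τ
      rw [hτ] at this
      linarith
    · -- `t = e`: then `c(t) = 0`, contradicting `c(t) = 64y² > 0`.
      rw [heq, hroot_e] at hct_pos
      exact absurd hct_pos (lt_irrefl 0)

/-- DESC-§22-H∞ (support): the `∞`-adic Selmer condition at the smallest real root.  For every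
`W : y² = x³ + a₂x² + a₄x + a₆` over `ℚ` with irreducible 2-division cubic, every real embedding `σ` of `L` minimising
`σ(θ)`, and every `P ∈ W(ℚ)`: `σ(κ(P)) > 0`.
REF1 §94: SURVIVES, PROVED, CLEARED; r3: `Irreducible` is necessary as typed (e5: the 2-torsion point `(−1,0)` of `y² = x³ − x` sits AT the
least root, `κ = 0` there).  REF2 v25 §1: KNOWN — Stoll 2001 Lemma 4.8 and sequel (image at `∞` = signs of `x − α` at the real roots `α`);
Silverman ATAEC V.2.3.1/2.4; Cassels 1991 §15 p. 46; formalisation; beyond-print no.  [cite: Stoll2001, Lemma 4.8] [cite: Cassels1991, §15] -/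
def KummerPositivityAtLeastRealRoot : Prop :=
  ∀ (W : WeierstrassCurve ℚ), W.a₁ = 0 → W.a₃ = 0 → Irreducible (twoDivisionUCubic W) →
    ∀ (σ : twoDivisionAlgebra W →ₐ[ℚ] ℝ), (∀ τ : twoDivisionAlgebra W →ₐ[ℚ] ℝ, σ (twoDivisionRoot W) ≤ τ (twoDivisionRoot W)) →
      ∀ (P : W.toAffine.Point), 0 < σ (kummerElt W P)

/-- Row DESC-§22-H∞ holds (`kummerElt_pos_of_isLeast_root`). -/
theorem kummerPositivityAtLeastRealRoot_holds : KummerPositivityAtLeastRealRoot :=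
  fun W h1 h3 hirr σ hmin P => kummerElt_pos_of_isLeast_root W h1 h3 hirr σ hmin P

/-! ## The real place with three real roots: the signs at `e₂ < e₃` agree

If `c_W` has three real roots `e₁ < e₂ < e₃` (real embeddings `σ₁, σ₂, σ₃`), then `c_W = (T−e₁)(T−e₂)(T−e₃)` over `ℝ`
(a quadratic vanishing at three points is zero) and `c_W(4x_P) = 64y_P² > 0` forces `4x_P > e₁` and
`(4x_P − e₂)(4x_P − e₃) > 0`: the point lies on the unbounded component (`4x_P > e₃`) or on the egg (`e₁ < 4x_P < e₂`).
So the full `∞`-adic Selmer condition on `κ(P)` is: `σ₁ > 0` and `sign σ₂ = sign σ₃`. -/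

/-- Explicit evaluation of `c_W` over `ℝ`. -/
lemma eval_map_twoDivisionUCubic (W : WeierstrassCurve ℚ) (s : ℝ) :
    ((twoDivisionUCubic W).map (algebraMap ℚ ℝ)).eval s =
      s ^ 3 + algebraMap ℚ ℝ W.b₂ * s ^ 2 + algebraMap ℚ ℝ (8 * W.b₄) * s + algebraMap ℚ ℝ (16 * W.b₆) := by
  simp only [twoDivisionUCubic, Polynomial.map_add, Polynomial.map_mul, Polynomial.map_pow, map_X, map_C,
    eval_add, eval_mul, eval_pow, eval_X, eval_C]

/-- A real quadratic form `g₂s² + g₁s + g₀` vanishing at three distinct points is identically zero. -/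
lemma quad_coeffs_eq_zero_of_three_roots (g₂ g₁ g₀ e₁ e₂ e₃ : ℝ) (h12 : e₁ ≠ e₂) (h13 : e₁ ≠ e₃) (h23 : e₂ ≠ e₃)
    (r1 : g₂ * e₁ ^ 2 + g₁ * e₁ + g₀ = 0) (r2 : g₂ * e₂ ^ 2 + g₁ * e₂ + g₀ = 0) (r3 : g₂ * e₃ ^ 2 + g₁ * e₃ + g₀ = 0) :
    g₂ = 0 ∧ g₁ = 0 ∧ g₀ = 0 := by
  have a : g₂ * (e₁ + e₂) + g₁ = 0 := by
    have := mul_left_cancel₀ (sub_ne_zero.mpr h12)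
      (show (e₁ - e₂) * (g₂ * (e₁ + e₂) + g₁) = (e₁ - e₂) * 0 by linear_combination r1 - r2)
    exact this
  have b : g₂ * (e₁ + e₃) + g₁ = 0 := by
    have := mul_left_cancel₀ (sub_ne_zero.mpr h13)
      (show (e₁ - e₃) * (g₂ * (e₁ + e₃) + g₁) = (e₁ - e₃) * 0 by linear_combination r1 - r3)
    exact this
  have hg2 : g₂ = 0 := by
    have := mul_left_cancel₀ (sub_ne_zero.mpr h23) (show (e₂ - e₃) * g₂ = (e₂ - e₃) * 0 by linear_combination a - b)
    exact this
  have hg1 : g₁ = 0 := by rw [hg2] at a; linarith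
  have hg0 : g₀ = 0 := by rw [hg2, hg1] at r1; linarith
  exact ⟨hg2, hg1, hg0⟩

/-- **THREE REAL ROOTS**: for real embeddings with `σ₁(θ) < σ₂(θ) < σ₃(θ)` and every `P ∈ W(ℚ)` (`c_W` irreducible):
`σ₁(κ(P)) > 0` and `σ₂(κ(P)) σ₃(κ(P)) > 0`. -/
theorem kummerElt_signs_of_three_real_roots (W : WeierstrassCurve ℚ) (h1 : W.a₁ = 0) (h3 : W.a₃ = 0)
    (hirr : Irreducible (twoDivisionUCubic W)) (σ₁ σ₂ σ₃ : twoDivisionAlgebra W →ₐ[ℚ] ℝ)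
    (h12 : σ₁ (twoDivisionRoot W) < σ₂ (twoDivisionRoot W)) (h23 : σ₂ (twoDivisionRoot W) < σ₃ (twoDivisionRoot W))
    (P : W.toAffine.Point) : 0 < σ₁ (kummerElt W P) ∧ 0 < σ₂ (kummerElt W P) * σ₃ (kummerElt W P) := by
  rcases P with _ | ⟨x, y, hP⟩
  · change 0 < σ₁ 1 ∧ 0 < σ₂ 1 * σ₃ 1
    simp only [map_one, mul_one]; exact ⟨one_pos, one_pos⟩
  · simp only [kummerElt_some, map_sub, AlgHom.commutes]
    set c : ℝ[X] := (twoDivisionUCubic W).map (algebraMap ℚ ℝ) with hc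
    set e₁ : ℝ := σ₁ (twoDivisionRoot W) with he₁
    set e₂ : ℝ := σ₂ (twoDivisionRoot W) with he₂
    set e₃ : ℝ := σ₃ (twoDivisionRoot W) with he₃
    set t : ℝ := algebraMap ℚ ℝ (4 * x) with ht
    set B : ℝ := algebraMap ℚ ℝ W.b₂ with hB
    set C : ℝ := algebraMap ℚ ℝ (8 * W.b₄) with hC
    set D : ℝ := algebraMap ℚ ℝ (16 * W.b₆) with hD
    have hroot : ∀ σ : twoDivisionAlgebra W →ₐ[ℚ] ℝ,
        σ (twoDivisionRoot W) ^ 3 + B * σ (twoDivisionRoot W) ^ 2 + C * σ (twoDivisionRoot W) + D = 0 := by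
      intro σ
      rw [← eval_map_twoDivisionUCubic W, eval_map, ← aeval_def]
      exact AdjoinRoot.aeval_algHom_eq_zero _ σ
    have hr1 := hroot σ₁
    have hr2 := hroot σ₂
    have hr3 := hroot σ₃
    rw [← he₁] at hr1
    rw [← he₂] at hr2
    rw [← he₃] at hr3
    have hy : y ≠ 0 := fun h0 => not_equation_zero_of_irreducible W h1 h3 hirr (h0 ▸ hP.1)
    have hct : t ^ 3 + B * t ^ 2 + C * t + D = algebraMap ℚ ℝ (64 * y ^ 2) := by
      rw [← eval_map_twoDivisionUCubic W, ht, eval_map, eval₂_hom, eval_twoDivisionUCubic_four_mul W h1 h3 hP.1]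
    have hct_pos : 0 < t ^ 3 + B * t ^ 2 + C * t + D := by
      rw [hct, eq_ratCast]
      have : (0 : ℚ) < 64 * y ^ 2 := by positivity
      exact_mod_cast this
    -- the quadratic `c(s) − (s−e₁)(s−e₂)(s−e₃)` vanishes at `e₁, e₂, e₃`, hence identically
    obtain ⟨hg2, hg1, hg0⟩ := quad_coeffs_eq_zero_of_three_roots (B + (e₁ + e₂ + e₃)) (C - (e₁ * e₂ + e₁ * e₃ + e₂ * e₃))
      (D + e₁ * e₂ * e₃) e₁ e₂ e₃ (ne_of_lt h12) (ne_of_lt (h12.trans h23)) (ne_of_lt h23)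
      (by linear_combination hr1) (by linear_combination hr2) (by linear_combination hr3)
    have hfact : t ^ 3 + B * t ^ 2 + C * t + D = (t - e₁) * ((t - e₂) * (t - e₃)) := by
      linear_combination t ^ 2 * hg2 + t * hg1 + hg0
    rw [hfact] at hct_pos
    have hpos1 : 0 < t - e₁ := by
      by_contra hle
      have hle : t - e₁ ≤ 0 := not_lt.mp hle
      have h2 : t - e₂ < 0 := by linarith
      have h3' : t - e₃ < 0 := by linarith
      have hq : 0 < (t - e₂) * (t - e₃) := mul_pos_of_neg_of_neg h2 h3'
      have : (t - e₁) * ((t - e₂) * (t - e₃)) ≤ 0 := mul_nonpos_of_nonpos_of_nonneg hle hq.le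
      linarith
    exact ⟨hpos1, (mul_pos_iff_of_pos_left hpos1).mp hct_pos⟩

/-- DESC-§22-H∞′ (support): the real-place Selmer condition with THREE real roots.  For every
`W : y² = x³ + a₂x² + a₄x + a₆` over `ℚ` with irreducible cubic, real embeddings `σ₁, σ₂, σ₃` with
`σ₁(θ) < σ₂(θ) < σ₃(θ)`, and every `P ∈ W(ℚ)`: `σ₁(κ(P)) > 0` and `σ₂(κ(P))·σ₃(κ(P)) > 0`.
REF1 §94: SURVIVES, PROVED, CLEARED.  REF2 v25 §1: KNOWN — Stoll 2001 Lemma 4.8 and sequel (sign vector at the real roots, constant on the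
components of `W(ℝ)`, dimension `m_∞ − 1 − g`); Silverman ATAEC V.2.3.1/2.4; formalisation; beyond-print no.  [cite: Stoll2001, Lemma 4.8] -/
def KummerRealSignsThreeRoots : Prop :=
  ∀ (W : WeierstrassCurve ℚ), W.a₁ = 0 → W.a₃ = 0 → Irreducible (twoDivisionUCubic W) →
    ∀ (σ₁ σ₂ σ₃ : twoDivisionAlgebra W →ₐ[ℚ] ℝ), σ₁ (twoDivisionRoot W) < σ₂ (twoDivisionRoot W) →
      σ₂ (twoDivisionRoot W) < σ₃ (twoDivisionRoot W) →
      ∀ (P : W.toAffine.Point), 0 < σ₁ (kummerElt W P) ∧ 0 < σ₂ (kummerElt W P) * σ₃ (kummerElt W P)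

/-- Row DESC-§22-H∞′ holds (`kummerElt_signs_of_three_real_roots`). -/
theorem kummerRealSignsThreeRoots_holds : KummerRealSignsThreeRoots :=
  fun W h1 h3 hirr σ₁ σ₂ σ₃ h12 h23 P => kummerElt_signs_of_three_real_roots W h1 h3 hirr σ₁ σ₂ σ₃ h12 h23 P

/-! ## The norm of the Kummer value: `N_{L/ℚ}(κ(P)) = c_W(4x_P) = 64 y_P²`

The first condition cutting `L^×/L^{×2}` down towards the Selmer group: the image of the Kummer map lies in the
kernel of the norm `L^×/L^{×2} → ℚ^×/ℚ^{×2}` (the census column `normsq`). -/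

/-- `N_{L/ℚ}(a − θ) = c_W(a)` (no irreducibility needed: the minimal polynomial of `θ` in `ℚ[T]/(c_W)` is `c_W`). -/
theorem norm_algebraMap_sub_twoDivisionRoot (W : WeierstrassCurve ℚ) (a : ℚ) :
    Algebra.norm ℚ (algebraMap ℚ (twoDivisionAlgebra W) a - twoDivisionRoot W) = (twoDivisionUCubic W).eval a := by
  classical
  let pb := AdjoinRoot.powerBasis (twoDivisionUCubic_monic W).ne_zero
  have hgen : pb.gen = twoDivisionRoot W := AdjoinRoot.powerBasis_gen _
  haveI : Module.Finite ℚ (twoDivisionAlgebra W) := pb.finite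
  haveI : Module.Free ℚ (twoDivisionAlgebra W) := Module.Free.of_basis pb.basis
  have hlm : Algebra.lmul ℚ (twoDivisionAlgebra W) (algebraMap ℚ (twoDivisionAlgebra W) a) =
      algebraMap ℚ (Module.End ℚ (twoDivisionAlgebra W)) a := by
    ext v; simp [Algebra.smul_def]
  rw [Algebra.norm_apply, map_sub, hlm, ← LinearMap.eval_charpoly, ← LinearMap.charpoly_toMatrix _ pb.basis,
    ← Algebra.leftMulMatrix_apply, ← hgen, charpoly_leftMulMatrix,
    AdjoinRoot.minpoly_powerBasis_gen_of_monic (twoDivisionUCubic_monic W)]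

/-- `N_{L/ℚ}(κ(P)) = 64 y_P²` for affine `P = (x_P, y_P)`, and `= 1` for `P = O`. -/
theorem norm_kummerElt_some (W : WeierstrassCurve ℚ) (h1 : W.a₁ = 0) (h3 : W.a₃ = 0) {x y : ℚ}
    (h : W.toAffine.Nonsingular x y) :
    Algebra.norm ℚ (kummerElt W (.some x y h)) = 64 * y ^ 2 := by
  rw [kummerElt_some, norm_algebraMap_sub_twoDivisionRoot, eval_twoDivisionUCubic_four_mul W h1 h3 h.1]

/-- **NORM CONDITION**: `N_{L/ℚ}(κ(P))` is a square in `ℚ` for every `P ∈ W(ℚ)`. -/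
theorem isSquare_norm_kummerElt (W : WeierstrassCurve ℚ) (h1 : W.a₁ = 0) (h3 : W.a₃ = 0) (P : W.toAffine.Point) :
    IsSquare (Algebra.norm ℚ (kummerElt W P)) := by
  rcases P with _ | ⟨x, y, hP⟩
  · change IsSquare (Algebra.norm ℚ (1 : twoDivisionAlgebra W)); rw [map_one]; exact ⟨1, by ring⟩
  · rw [norm_kummerElt_some W h1 h3 hP]; exact ⟨8 * y, by ring⟩

/-- DESC-§22-HN (support): the norm condition on the Kummer image.  For every `W : y² = x³ + a₂x² + a₄x + a₆`
over `ℚ` and every `P ∈ W(ℚ)`, `N_{L/ℚ}(κ(P)) ∈ ℚ^{×2}` (indeed `= 64 y_P²`, resp. `1`).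
REF1 §94: SURVIVES, PROVED, CLEARED; r1: the hypotheses `W.a₁ = 0 → W.a₃ = 0 →` are not used — `N(κ(P)) = (4(2y + a₁x + a₃))²` for every
`W` (REF1 e4 over `norm_algebraMap_sub_twoDivisionRoot`); kept as typed by the planner (uniform binders across rows H′–HN).  REF2 v25 §1: KNOWN —
Cassels 1991 §15 «Norm(a − Θ) = F(a)», `𝓜 = {Norm ∈ (ℚ^×)²}` p. 42; formalisation; beyond-print no.  [cite: Cassels1991, §15 p. 42] -/
def KummerNormIsSquare : Prop :=
  ∀ (W : WeierstrassCurve ℚ), W.a₁ = 0 → W.a₃ = 0 → ∀ (P : W.toAffine.Point), IsSquare (Algebra.norm ℚ (kummerElt W P))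

/-- Row DESC-§22-HN holds (`isSquare_norm_kummerElt`). -/
theorem kummerNormIsSquare_holds : KummerNormIsSquare := fun W h1 h3 P => isSquare_norm_kummerElt W h1 h3 P

end Summit.BirchSwinnertonDyer.Rank1Residual.F1Sign2.Kummer
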